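import Literature.MathematicalPhysics.QuantumFieldTheory.Balaban1983to89.B9Eq334LaplaceACovariance
import Literature.MathematicalPhysics.QuantumFieldTheory.Balaban1983to89.B11Eq115GaugeIsometry

/-!
# `Balaban1983to89.B11Eq117GaugeNormInvariance` — T. Bałaban, *The variational problem and background fields in renormalization group method for
# lattice gauge theories*, Commun. Math. Phys. **102** (1985) 277–309 [Balaban1985Variational] (117) p. 295 («the norm of the transformation») with
# *Propagators …*, Commun. Math. Phys. **99** (1985) 389–434 [Balaban1985BackgroundPropagators] (3.34) p. 396: THE OPERATOR NORM OF THE CHART LETTER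
# `H₁(U) : |·|_{(−0)} → (115)` OF THE pub-balaban NE9 CHAIN IS GAUGE INVARIANT — `H₁(U^u) = R(u)H₁(U)R(u₁)⁻¹` between gauge-isometric carriers,
# hence `‖H₁(U^u)‖ = ‖H₁(U)‖`; the same for every block transformation conjugated by `R(u)`

statement-level skeleton of published theorems with citation tags; proofs where landed; nothing here is a claim about the Yang–Mills mass gap

PDF held: `paper:balaban1985-cmp99-background-propagators` p. 396 (text layer, read 2026-08-22); [Balaban1985Variational] (115)/(117) via the tree's
`B11Eq115Space` / `B11Eq111FrakG` docstrings.

THE PRINT.  [B9] p. 396 (3.34): *«G(U^u) = R(u)G(U)R(u⁻¹)»*; [B11] p. 295 (117) (as typed in `B11Eq111FrakG.toCLM115`): *«the norm max{|·|_{(−1)},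
|∇·|_{(−2)}} of the transformation»*.

WHY THIS FILE (cell context).  The pub-balaban NE9 chart radii are functions of the operator norms of the letters read in the (115)-currency
(`B9Eq3126H1BoundCLM.exists_H1_frakG_CLM_bound_of_small_field`: `‖H1LatticeCLM …(∇_U)‖ ≤ C_H′` uniformly over the small-field set).  With the
(115)-carrier gauge isometric (`B11Eq115GaugeIsometry.gauge115Isometry`), the sup carrier of the block fields gauge isometric (`gaugeNeg`) and the
Hilbert-level `H₁` conjugated (`B9Eq334LaplaceACovariance.H1ofU_gaugeU`), the CLM letter is conjugated by isometries and its operator norm is a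
gauge-invariant function of `U` — so (K)'s bound holds verbatim on the gauge orbit of the small-field ball.  This file proves the generic opnorm
lemma, the conjugation of `B11Eq103H1Complex.blockCLM115`/`H1CLM`/`H1LatticeCLM`, and the norm equality.

WHAT IS PROVED (sorry-free; 0 `def`; no inequality of the papers).
* §1 [folklore] **`opNorm_eq_of_isometry_conj`** — `A′ S = T A` with `S`, `T` linear isometry equivalences ⇒ `‖A′‖ = ‖A‖`
  (`ContinuousLinearMap.opNorm_comp_linearIsometryEquiv`, `LinearIsometry.norm_toContinuousLinearMap_comp`).
* §2 `symm_funEquiv_conj` (junction), **`blockCLM115_gaugeU`** (a block transformation `T : (β → 𝔸) → (Bond → 𝔸)` read in `|·|_{(−0)} → (115)` is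
  conjugated by `R(u)` whenever its function-level map is), **`opNorm_blockCLM115_gaugeU`** (`‖·‖` equal, `u(x) ∈ U1`).
* §4 `toCLM115_conj` ∕ `opNorm_toCLM115_conj` (currents `|·|_{(−3)} → (115)`), `frakGLin_fun_apply` (the function-level `𝔊` of
  `frakGLatticeCLM` IS the Hilbert-level `𝔊` read on the functions), **`frakGLatticeCLM_gaugeU`**, **`opNorm_frakGLatticeCLM_gaugeU`** — `‖𝔊(U^u)‖ = ‖𝔊(U)‖`.
* §3 **`H1LatticeCLM_gaugeU`** — `H₁(U^u) R(u₁) = R(u) H₁(U)` for the chain's `B11Eq103H1Complex.H1LatticeCLM` at ANY `Q`-slots intertwined by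
  `R(u)` and a unitary `T_F = R(u₁)` on the block fields (e.g. `Q := Q(U)`, `Q′ := Q(U^u)`, `u₁ = u ∘ centre`, `B9Eq333ProjectionCovariance.QtorusW_gaugeU`);
  **`opNorm_H1LatticeCLM_gaugeU`** — `‖H₁(U^u)‖ = ‖H₁(U)‖` in `|·|_{(−0)} → (115)` (given `hAd`, `hτ`, `hstar`, `u(x) ∈ U1`).
MODEL / DECLARED READINGS.  (M1) the tree's encodings verbatim; (M2) DISPLAYED: `hAd`, `hτ`, `hstar`, `u(x) ∈ U1`, positivity and `Q` onto on both
sides (one side derivable: `B9Eq334LaplaceACovariance.hpos_gaugeU`, `QtorusW` onto is per witness); (M3) NOT HERE: the chart (S′) on the orbit (its remaining letters `C(U)`, `W`, the regimes' scalars), any bound.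
HONEST SCOPE.  [folklore] operator-norm bookkeeping under isometric conjugation on the cell's own typed carriers; no estimate of the papers; NOT
summit progress (cell pub-balaban: NE9 NOT PRINTED / NOT PROVED; «NE9 ⇐ the named binders»; spine PROVED 0/9; HONEST DEPENDENCY: continuum YM on T⁴ ⇐
BetaPertH ∧ nine spine estimates (0/9 proved); BetaPertH ⇐ (D1) ∧ (D4) ∧ CAP+tail; G-an2-4 gates asym, D1 and NE2/3/4).  Unit
`b2b-balaban-t4-ne9-formalise-leaf-03` (NE9 crux-team leaf prover, gen 60), INTENT I-ne9leaf03-g60-1 file (G6); NEW file importing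
`B9Eq334LaplaceACovariance` + `B11Eq115GaugeIsometry`; modifies nothing.  Net new unproved facts: 0.
-/

noncomputable section

open scoped InnerProductSpace ComplexConjugate BigOperators

namespace Literature.MathematicalPhysics.QuantumFieldTheory.Balaban1983to89.B11Eq117GaugeNormInvariance

open B9SectCLatticeCarrier (Bond bpos btgt)
open B4Sect5Torus (TSite)
open B9Eq311L2Pairing (WL2)
open B9Eq319QprimeTorus (fineP)
open B11Eq115Space (NegSup JetSup Space115 NegSize levWeight)
open B11Eq111FrakG (nabla115)
open B11Eq103H1Complex (BondL2K funEquiv funEquiv_apply funEquiv_symm_apply readFun readFun_apply blockCLM115 blockCLM115_apply H1CLM H1LatticeCLM)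
open B9Eq310HessianOperator (adTransportW hessOp)
open B9Eq326OperatorAssembly (RofU laplaceAofU H1ofU)
open B7Prop1Explicit (U1)
open B9Eq328GaugeAction B9Eq333ProjectionCovariance B9Eq334LaplaceACovariance B11Eq115GaugeIsometry

variable {d : ℕ}

/-! ## §1 Operator norms are invariant under conjugation by linear isometry equivalences -/

section OpNorm

variable {E E' F F' : Type*} [NormedAddCommGroup E] [NormedSpace ℂ E] [NormedAddCommGroup E'] [NormedSpace ℂ E'] [NormedAddCommGroup F]
  [NormedSpace ℂ F] [NormedAddCommGroup F'] [NormedSpace ℂ F']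

/-- [folklore] **`A′ S = T A` with `S`, `T` linear isometry equivalences ⇒ `‖A′‖ = ‖A‖`** — print's «R(u)…R(u⁻¹)» does not change an operator
norm. [cite: Balaban1985BackgroundPropagators, (3.34) p.396, p.398] -/
theorem opNorm_eq_of_isometry_conj (S : E ≃ₗᵢ[ℂ] E') (T : F ≃ₗᵢ[ℂ] F') (A : E →L[ℂ] F) (A' : E' →L[ℂ] F') (h : ∀ x, A' (S x) = T (A x)) :
    ‖A'‖ = ‖A‖ := by
  have hA' : A' = (T : F →L[ℂ] F').comp (A.comp (S.symm : E' →L[ℂ] E)) := by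
    ext x'
    have hx := h (S.symm x')
    rw [LinearIsometryEquiv.apply_symm_apply] at hx
    rw [hx]
    rfl
  rw [hA', ContinuousLinearMap.opNorm_linearIsometryEquiv_comp, ContinuousLinearMap.opNorm_comp_linearIsometryEquiv]

end OpNorm

/-! ## §2 Block transformations read in `|·|_{(−0)} → (115)` are conjugated by `R(u)` -/

section Block

variable {Pd : Fin d → ℕ} {β : Type*} [Fintype β] {𝔸 : Type*} [NormedRing 𝔸] [NormedAlgebra ℂ 𝔸] [NormOneClass 𝔸] [FiniteDimensional ℂ 𝔸]
  {L η : ℝ} [Fact (0 < L)] [Fact (0 < η)] {lev₀ : Bond d Pd → ℕ} {levB : β → ℕ} (lev₁ : Bond d Pd × Fin d → ℕ)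
  (g : TSite d Pd → 𝔸ˣ) (U V : Bond d Pd → 𝔸ˣ) (u : β → 𝔸ˣ)

omit [NormOneClass 𝔸] in
/-- **A block transformation read in `|·|_{(−0)} → (115)` (`B11Eq103H1Complex.blockCLM115`) IS CONJUGATED whenever its function-level map is**:
`T′(R(u₁)F) = R(u)(TF)` ⇒ `blockCLM115 (∇_V) T′ (R(u₁)B) = R(u) (blockCLM115 (∇_U) T B)` — for any two derivative indices.
[cite: Balaban1985Variational, (103) p.293, (115) p.294; Balaban1985BackgroundPropagators, (3.34) p.396] -/
theorem blockCLM115_conj (T T' : (β → 𝔸) →ₗ[ℂ] (Bond d Pd → 𝔸)) (hT : ∀ F : β → 𝔸, T' (fun c => AdA (u c) (F c)) = gaugeA g (T F))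
    (B : NegSize L η levB 0 𝔸) :
    blockCLM115 (L := L) (η := η) (lev₀ := lev₀) (levB := levB) lev₁ (nabla115 η V) T'
        ((NegSup.equiv (levWeight L η levB 0) 𝔸).symm fun c => AdA (u c) (NegSup.equiv (levWeight L η levB 0) 𝔸 B c)) =
      gauge115 g U V (blockCLM115 (L := L) (η := η) (lev₀ := lev₀) (levB := levB) lev₁ (nabla115 η U) T B) := by
  apply (JetSup.equiv (levWeight L η lev₀ 1) (levWeight L η lev₁ 2) (nabla115 η V)).injective
  rw [blockCLM115_apply, equiv_gauge115, blockCLM115_apply, Equiv.apply_symm_apply, hT]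

/-- **… HENCE ITS OPERATOR NORM IS GAUGE INVARIANT** (`u(x)`, `u₁(c) ∈ U1`, `V = U^u`). [cite: Balaban1985Variational, (117) p.295; Balaban1985BackgroundPropagators, (3.34) p.396] -/
theorem opNorm_blockCLM115_conj (hg : ∀ x, g x ∈ U1 𝔸) (hu : ∀ c, u c ∈ U1 𝔸) (T T' : (β → 𝔸) →ₗ[ℂ] (Bond d Pd → 𝔸))
    (hT : ∀ F : β → 𝔸, T' (fun c => AdA (u c) (F c)) = gaugeA g (T F)) :
    ‖blockCLM115 (L := L) (η := η) (lev₀ := lev₀) (levB := levB) lev₁ (nabla115 η (gaugeU g U)) T'‖ =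
      ‖blockCLM115 (L := L) (η := η) (lev₀ := lev₀) (levB := levB) lev₁ (nabla115 η U) T‖ :=
  opNorm_eq_of_isometry_conj (gaugeNeg (w := levWeight L η levB 0) u hu) (gauge115Isometry (lev₀ := lev₀) (lev₁ := lev₁) hg U) _ _
    fun B => blockCLM115_conj lev₁ g U (gaugeU g U) u T T' hT B

end Block

/-! ## §3 The chain's `H₁` in the (115)-currency: `H₁(U^u) R(u₁) = R(u) H₁(U)` and `‖H₁(U^u)‖ = ‖H₁(U)‖` -/

section H1

variable (L : ℕ) [NeZero L] (m : Fin d → ℕ) {β : Type*} [Fintype β]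
  {𝔸 : Type*} [NormedRing 𝔸] [NormedAlgebra ℂ 𝔸] [NormOneClass 𝔸] [FiniteDimensional ℂ 𝔸] [StarRing 𝔸] [StarModule ℂ 𝔸]
  {W : Type*} [NormedAddCommGroup W] [InnerProductSpace ℂ W] [FiniteDimensional ℂ W] (φ : W ≃ₗ[ℂ] 𝔸) {c₀ : ℝ} [Fact (0 < c₀)]
  {Lr η : ℝ} [Fact (0 < Lr)] [Fact (0 < η)] {lev₀ : Bond d (fineP L m) → ℕ} {levB : β → ℕ} (lev₁ : Bond d (fineP L m) × Fin d → ℕ)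
  (τ : 𝔸 →ₗ[ℂ] ℂ) {g : TSite d (fineP L m) → 𝔸ˣ} (U : Bond d (fineP L m) → 𝔸ˣ) {wB : β → ℝ} [Fact (∀ c, 0 < wB c)] (u : β → 𝔸ˣ)
  {Q Q' : BondL2K ℂ d (fineP L m) c₀ W →ₗ[ℂ] WL2 ℂ wB W} {a : ℝ}
  (hτ : ∀ (x : TSite d (fineP L m)) (X : 𝔸), τ (AdA (g x) X) = τ X) (hstar : ∀ x, star (g x : 𝔸) = ((g x)⁻¹ : 𝔸ˣ))
  (hAd : ∀ (x : TSite d (fineP L m)) (v v' : W), ⟪AdW φ (g x) v, AdW φ (g x) v'⟫_ℂ = ⟪v, v'⟫_ℂ)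
  (hAdu : ∀ (c : β) (v v' : W), ⟪AdW φ (u c) v, AdW φ (u c) v'⟫_ℂ = ⟪v, v'⟫_ℂ)
  (hQ : ∀ f, Q' (gaugeW φ (fun b : Bond d (fineP L m) => g (bpos b)) f) = gaugeW φ u (Q f))
  (hpos : ∀ x : BondL2K ℂ d (fineP L m) c₀ W, x ≠ 0 → 0 < RCLike.re ⟪x, laplaceAofU L m φ η U τ Q a x⟫_ℂ)
  (hpos' : ∀ x : BondL2K ℂ d (fineP L m) c₀ W, x ≠ 0 → 0 < RCLike.re ⟪x, laplaceAofU L m φ η (gaugeU g U) τ Q' a x⟫_ℂ)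
  (hQs : Function.Surjective Q) (hQs' : Function.Surjective Q')

omit [Fintype β] [NormOneClass 𝔸] [FiniteDimensional ℂ 𝔸] [StarRing 𝔸] [StarModule ℂ 𝔸] [FiniteDimensional ℂ W] [Fact (∀ c, 0 < wB c)] [NeZero L] in
/-- JUNCTION: a conjugated block function read on the Hilbert fibre is the gauge-transformed Hilbert-level block field —
`(funEquiv φ)⁻¹ (c ↦ u(c)F(c)u(c)⁻¹) = R(u)((funEquiv φ)⁻¹ F)`. [cite: Balaban1985Averaging, (18)–(19) p.21; Balaban1985BackgroundPropagators, (3.28) p.395] -/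
theorem symm_funEquiv_conj (F : β → 𝔸) : (funEquiv φ wB).symm (fun c => AdA (u c) (F c)) = gaugeW φ u ((funEquiv φ wB).symm F) := by
  apply (WL2.equiv ℂ wB W).injective
  funext c
  rw [funEquiv_symm_apply, equiv_gaugeW, funEquiv_symm_apply, AdW_apply, LinearEquiv.apply_symm_apply, AdA_apply]

omit [NormOneClass 𝔸] in
include hτ hstar hAd hAdu hQ in
set_option maxHeartbeats 1600000 in
-- the positivity witnesses are re-read through `laplaceAofU` = `laplaceALatticeK …` (one `δ`-step per letter; slow `whnf`, cf. `B9Eq386LipschitzH1`)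
/-- **`H₁(U^u) R(u₁) = R(u) H₁(U)` FOR THE CHAIN'S `H₁` READ IN `|·|_{(−0)} → (115)`** (`B11Eq103H1Complex.H1LatticeCLM` at the assembled slots of
`B9Eq326OperatorAssembly`, any `Q`-slots intertwined as displayed): the Hilbert-level conjugation `B9Eq334LaplaceACovariance.H1ofU_gaugeU` read through
`funEquiv φ`. [cite: Balaban1985Variational, (103) p.293, (174) p.305; Balaban1985BackgroundPropagators, (3.34) p.396, (3.126) p.420] -/
theorem H1LatticeCLM_gaugeU (B : NegSize Lr η levB 0 𝔸) :
    H1LatticeCLM (L := Lr) (η := η) (lev₀ := lev₀) (levB := levB) φ (c := ((η : ℂ))⁻¹) (R := adTransportW φ (gaugeU g U))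
        (S := adTransportW φ fun b => (gaugeU g U b)⁻¹)
        (Δ₁ := hessOp φ η (gaugeU g U) τ) (Rr := RofU L m φ η (gaugeU g U)) (Q := Q') (a := a) hpos' hQs' lev₁ (nabla115 η (gaugeU g U))
        ((NegSup.equiv (levWeight Lr η levB 0) 𝔸).symm fun c => AdA (u c) (NegSup.equiv (levWeight Lr η levB 0) 𝔸 B c)) =
      gauge115 g U (gaugeU g U) (H1LatticeCLM (L := Lr) (η := η) (lev₀ := lev₀) (levB := levB) φ (c := ((η : ℂ))⁻¹) (R := adTransportW φ U)
        (S := adTransportW φ fun b => (U b)⁻¹) (Δ₁ := hessOp φ η U τ) (Rr := RofU L m φ η U) (Q := Q) (a := a) hpos hQs lev₁ (nabla115 η U) B) := by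
  refine blockCLM115_conj lev₁ g U (gaugeU g U) u (readFun φ wB (fun _ : Bond d (fineP L m) => c₀) (H1ofU L m φ η U τ hpos hQs))
    (readFun φ wB (fun _ : Bond d (fineP L m) => c₀) (H1ofU L m φ η (gaugeU g U) τ hpos' hQs')) (fun F => ?_) B
  rw [readFun_apply, readFun_apply, symm_funEquiv_conj]
  have hTF : ∀ h h' : WL2 ℂ wB W, ⟪gaugeW φ u h, gaugeW φ u h'⟫_ℂ = ⟪h, h'⟫_ℂ := fun h h' => inner_gaugeW φ (w := wB) u hAdu h h'
  have h1 := H1ofU_gaugeU L m φ τ η U (gaugeW φ u) hτ hstar hAd hTF hQ hpos hpos' hQs hQs' ((funEquiv φ wB).symm F)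
  exact (congrArg (funEquiv φ (fun _ : Bond d (fineP L m) => c₀)) h1).trans (toAlg_gaugeW_eq_gaugeA φ g _)

include hτ hstar hAd hAdu hQ in
set_option maxHeartbeats 1600000 in
-- as above
/-- **`‖H₁(U^u)‖ = ‖H₁(U)‖` IN THE (115)-CURRENCY** (`u(x)`, `u₁(c) ∈ U1`): the letter whose uniform bound over the small-field set fixes the chart
radii (`B9Eq3126H1BoundCLM`) is a GAUGE-INVARIANT function of the background. [cite: Balaban1985Variational, (117) p.295; Balaban1985BackgroundPropagators, (3.34) p.396, (3.126) p.420] -/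
theorem opNorm_H1LatticeCLM_gaugeU (hg : ∀ x, g x ∈ U1 𝔸) (hu : ∀ c, u c ∈ U1 𝔸) :
    ‖H1LatticeCLM (L := Lr) (η := η) (lev₀ := lev₀) (levB := levB) φ (c := ((η : ℂ))⁻¹) (R := adTransportW φ (gaugeU g U))
        (S := adTransportW φ fun b => (gaugeU g U b)⁻¹) (Δ₁ := hessOp φ η (gaugeU g U) τ) (Rr := RofU L m φ η (gaugeU g U)) (Q := Q') (a := a)
        hpos' hQs' lev₁ (nabla115 η (gaugeU g U))‖ =
      ‖H1LatticeCLM (L := Lr) (η := η) (lev₀ := lev₀) (levB := levB) φ (c := ((η : ℂ))⁻¹) (R := adTransportW φ U)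
        (S := adTransportW φ fun b => (U b)⁻¹) (Δ₁ := hessOp φ η U τ) (Rr := RofU L m φ η U) (Q := Q) (a := a) hpos hQs lev₁ (nabla115 η U)‖ :=
  opNorm_eq_of_isometry_conj (gaugeNeg (w := levWeight Lr η levB 0) u hu) (gauge115Isometry (lev₀ := lev₀) (lev₁ := lev₁) hg U) _ _
    fun B => H1LatticeCLM_gaugeU L m φ lev₁ τ U u hτ hstar hAd hAdu hQ hpos hpos' hQs hQs' B

end H1

/-! ## §4 The chain's `𝔊` in the (115)-currency: `𝔊(U^u) R(u) = R(u) 𝔊(U)` and `‖𝔊(U^u)‖ = ‖𝔊(U)‖` -/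

section Current

variable {Pd : Fin d → ℕ} {𝔸 : Type*} [NormedRing 𝔸] [NormedAlgebra ℂ 𝔸] [NormOneClass 𝔸] [FiniteDimensional ℂ 𝔸]
  {L η : ℝ} [Fact (0 < L)] [Fact (0 < η)] {lev₀ : Bond d Pd → ℕ} (lev₁ : Bond d Pd × Fin d → ℕ)
  (g : TSite d Pd → 𝔸ˣ) (U V : Bond d Pd → 𝔸ˣ)

omit [NormOneClass 𝔸] in
/-- **A transformation of the currents read in `|·|_{(−3)} → (115)` (`B11Eq111FrakG.toCLM115`) IS CONJUGATED whenever its function-level map is.**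
[cite: Balaban1985Variational, (117) p.295; Balaban1985BackgroundPropagators, (3.34) p.396] -/
theorem toCLM115_conj (T T' : (Bond d Pd → 𝔸) →ₗ[ℂ] (Bond d Pd → 𝔸)) (hT : ∀ F, T' (gaugeA g F) = gaugeA g (T F)) (J : NegSize L η lev₀ 3 𝔸) :
    B11Eq111FrakG.toCLM115 (L := L) (η := η) (lev₀ := lev₀) lev₁ (nabla115 η V) T'
        ((NegSup.equiv (levWeight L η lev₀ 3) 𝔸).symm fun b => AdA (g (bpos b)) (NegSup.equiv (levWeight L η lev₀ 3) 𝔸 J b)) =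
      gauge115 g U V (B11Eq111FrakG.toCLM115 (L := L) (η := η) (lev₀ := lev₀) lev₁ (nabla115 η U) T J) := by
  apply (JetSup.equiv (levWeight L η lev₀ 1) (levWeight L η lev₁ 2) (nabla115 η V)).injective
  rw [B11Eq111FrakG.toCLM115_apply, equiv_gauge115, B11Eq111FrakG.toCLM115_apply, Equiv.apply_symm_apply]
  exact hT _

/-- **… hence its operator norm is gauge invariant** (`u(x) ∈ U1`, `V = U^u`). [cite: Balaban1985Variational, (117) p.295; Balaban1985BackgroundPropagators, (3.34) p.396] -/
theorem opNorm_toCLM115_conj (hg : ∀ x, g x ∈ U1 𝔸) (T T' : (Bond d Pd → 𝔸) →ₗ[ℂ] (Bond d Pd → 𝔸)) (hT : ∀ F, T' (gaugeA g F) = gaugeA g (T F)) :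
    ‖B11Eq111FrakG.toCLM115 (L := L) (η := η) (lev₀ := lev₀) lev₁ (nabla115 η (gaugeU g U)) T'‖ =
      ‖B11Eq111FrakG.toCLM115 (L := L) (η := η) (lev₀ := lev₀) lev₁ (nabla115 η U) T‖ :=
  opNorm_eq_of_isometry_conj (gaugeNeg (w := levWeight L η lev₀ 3) (fun b : Bond d Pd => g (bpos b)) fun _ => hg _)
    (gauge115Isometry (lev₀ := lev₀) (lev₁ := lev₁) hg U) _ _ fun J => toCLM115_conj lev₁ g U (gaugeU g U) T T' hT J

end Current

section FrakG

variable (L : ℕ) (m : Fin d → ℕ) {β : Type*} [Fintype β] {𝔸 : Type*} [NormedRing 𝔸] [NormedAlgebra ℂ 𝔸]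
  {W : Type*} [NormedAddCommGroup W] [InnerProductSpace ℂ W] [FiniteDimensional ℂ W] (φ : W ≃ₗ[ℂ] 𝔸) {c₀ : ℝ} [Fact (0 < c₀)]
  {g : TSite d (fineP L m) → 𝔸ˣ} {wB : β → ℝ} [Fact (∀ c, 0 < wB c)] {Q : BondL2K ℂ d (fineP L m) c₀ W →ₗ[ℂ] WL2 ℂ wB W} {a : ℝ}

/-- **The function-level letter `𝔊` of `B11Eq103H1Complex.frakGLatticeCLM` IS the Hilbert-level `𝔊` read on the functions**: the five `readFun`-type
letters telescope (`fe⁻¹ ∘ fe = 1`). [cite: Balaban1985Variational, (111) p.294; Balaban1985BackgroundPropagators, (3.153) p.426] -/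
theorem frakGLin_fun_apply {c : ℂ} {R S : Bond d (fineP L m) → W →ₗ[ℂ] W} {Δ₁ : BondL2K ℂ d (fineP L m) c₀ W →ₗ[ℂ] BondL2K ℂ d (fineP L m) c₀ W}
    {Rr : B11Eq103H1Complex.SiteL2K ℂ d (fineP L m) c₀ W →ₗ[ℂ] B11Eq103H1Complex.SiteL2K ℂ d (fineP L m) c₀ W}
    (hposK : ∀ x : BondL2K ℂ d (fineP L m) c₀ W, x ≠ 0 → 0 < RCLike.re ⟪x, B11Eq103H1Complex.laplaceALatticeK c R S Δ₁ Rr Q a x⟫_ℂ)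
    (hQK : Function.Surjective Q) (F : Bond d (fineP L m) → 𝔸) :
    B11Eq111FrakG.frakGLin (B11Eq103H1Complex.G1Fun φ (B11Eq103H1Complex.G1LatticeK hposK)) (B11Eq103H1Complex.QFun φ Q)
        (B11Eq103H1Complex.QadjFun φ Q) (B11Eq103H1Complex.KinvLatticeK hposK hQK)
        (B11Eq103H1Complex.DFun φ (B11Eq103H1Complex.covDerivL2K ℂ c₀ c R)) Rr
        (B11Eq103H1Complex.DstarFun φ (B11Eq103H1Complex.covDivL2K ℂ c₀ c S)) F =
      funEquiv φ (fun _ : Bond d (fineP L m) => c₀) (B11Eq103H1Complex.frakGLatticeK hposK hQK ((funEquiv φ (fun _ : Bond d (fineP L m) => c₀)).symm F)) := by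
  rw [B11Eq103H1Complex.frakGLatticeK, B11Eq111FrakG.frakGLin_apply, B11Eq111FrakG.frakGLin_apply]
  simp only [B11Eq103H1Complex.G1Fun, B11Eq103H1Complex.QFun, B11Eq103H1Complex.QadjFun, B11Eq103H1Complex.DFun, B11Eq103H1Complex.DstarFun,
    readFun_apply, LinearMap.comp_apply, LinearEquiv.coe_coe, LinearEquiv.symm_apply_apply, map_sub]

omit [Fintype β] [FiniteDimensional ℂ W] [Fact (∀ c, 0 < wB c)] [Fact (0 < c₀)] in
/-- JUNCTION: `(funEquiv φ)⁻¹(R(u)F) = R(u)((funEquiv φ)⁻¹F)` on the bond functions. [cite: Balaban1985BackgroundPropagators, (3.28) p.395] -/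
theorem symm_funEquiv_gaugeA (F : Bond d (fineP L m) → 𝔸) :
    (funEquiv φ (fun _ : Bond d (fineP L m) => c₀)).symm (gaugeA g F) =
      gaugeW φ (fun b : Bond d (fineP L m) => g (bpos b)) ((funEquiv φ (fun _ : Bond d (fineP L m) => c₀)).symm F) := by
  apply (WL2.equiv ℂ (fun _ : Bond d (fineP L m) => c₀) W).injective
  funext b
  rw [funEquiv_symm_apply, equiv_gaugeW, funEquiv_symm_apply, AdW_apply, LinearEquiv.apply_symm_apply, gaugeA_apply, AdA_apply]

variable [NeZero L] [NormOneClass 𝔸] [FiniteDimensional ℂ 𝔸] [StarRing 𝔸] [StarModule ℂ 𝔸] {Lr η : ℝ} [Fact (0 < Lr)] [Fact (0 < η)]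
  {lev₀ : Bond d (fineP L m) → ℕ} (lev₁ : Bond d (fineP L m) × Fin d → ℕ) (τ : 𝔸 →ₗ[ℂ] ℂ) (U : Bond d (fineP L m) → 𝔸ˣ) (u : β → 𝔸ˣ)
  {Q' : BondL2K ℂ d (fineP L m) c₀ W →ₗ[ℂ] WL2 ℂ wB W}
  (hτ : ∀ (x : TSite d (fineP L m)) (X : 𝔸), τ (AdA (g x) X) = τ X) (hstar : ∀ x, star (g x : 𝔸) = ((g x)⁻¹ : 𝔸ˣ))
  (hAd : ∀ (x : TSite d (fineP L m)) (v v' : W), ⟪AdW φ (g x) v, AdW φ (g x) v'⟫_ℂ = ⟪v, v'⟫_ℂ)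
  (hAdu : ∀ (c : β) (v v' : W), ⟪AdW φ (u c) v, AdW φ (u c) v'⟫_ℂ = ⟪v, v'⟫_ℂ)
  (hQ : ∀ f, Q' (gaugeW φ (fun b : Bond d (fineP L m) => g (bpos b)) f) = gaugeW φ u (Q f))
  (hpos : ∀ x : BondL2K ℂ d (fineP L m) c₀ W, x ≠ 0 → 0 < RCLike.re ⟪x, laplaceAofU L m φ η U τ Q a x⟫_ℂ)
  (hpos' : ∀ x : BondL2K ℂ d (fineP L m) c₀ W, x ≠ 0 → 0 < RCLike.re ⟪x, laplaceAofU L m φ η (gaugeU g U) τ Q' a x⟫_ℂ)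
  (hQs : Function.Surjective Q) (hQs' : Function.Surjective Q')

omit [NormOneClass 𝔸] in
include hτ hstar hAd hAdu hQ in
set_option maxHeartbeats 1600000 in
set_option maxRecDepth 8192 in
-- slow `whnf` ∕ deep unification through the implicit letters of the CLM letter, as in §3
/-- **`𝔊(U^u) R(u) = R(u) 𝔊(U)` FOR THE CHAIN'S `𝔊` READ IN `|·|_{(−3)} → (115)`** (`B11Eq103H1Complex.frakGLatticeCLM` at the assembled slots):
the Hilbert-level conjugation `B9Eq334LaplaceACovariance.frakGofU_gaugeU` read through `funEquiv φ`. [cite: Balaban1985Variational, (111) p.294, (117) p.295; Balaban1985BackgroundPropagators, (3.34) p.396, (3.153) p.426] -/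
theorem frakGLatticeCLM_gaugeU (J : NegSize Lr η lev₀ 3 𝔸) :
    B11Eq103H1Complex.frakGLatticeCLM (L := Lr) (η := η) (lev₀ := lev₀) φ (c := ((η : ℂ))⁻¹) (R := adTransportW φ (gaugeU g U))
        (S := adTransportW φ fun b => (gaugeU g U b)⁻¹) (Δ₁ := hessOp φ η (gaugeU g U) τ) (Rr := RofU L m φ η (gaugeU g U)) (Q := Q') (a := a)
        hpos' hQs' lev₁ (nabla115 η (gaugeU g U))
        ((NegSup.equiv (levWeight Lr η lev₀ 3) 𝔸).symm fun b => AdA (g (bpos b)) (NegSup.equiv (levWeight Lr η lev₀ 3) 𝔸 J b)) =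
      gauge115 g U (gaugeU g U) (B11Eq103H1Complex.frakGLatticeCLM (L := Lr) (η := η) (lev₀ := lev₀) φ (c := ((η : ℂ))⁻¹) (R := adTransportW φ U)
        (S := adTransportW φ fun b => (U b)⁻¹) (Δ₁ := hessOp φ η U τ) (Rr := RofU L m φ η U) (Q := Q) (a := a) hpos hQs lev₁ (nabla115 η U) J) := by
  refine toCLM115_conj lev₁ g U (gaugeU g U)
    (B11Eq111FrakG.frakGLin
      (B11Eq103H1Complex.G1Fun φ (B11Eq103H1Complex.G1LatticeK (c := ((η : ℂ))⁻¹) (R := adTransportW φ U) (S := adTransportW φ fun b => (U b)⁻¹)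
        (Δ₁ := hessOp φ η U τ) (Rr := RofU L m φ η U) (Q := Q) (a := a) hpos))
      (B11Eq103H1Complex.QFun φ Q) (B11Eq103H1Complex.QadjFun φ Q)
      (B11Eq103H1Complex.KinvLatticeK (c := ((η : ℂ))⁻¹) (R := adTransportW φ U) (S := adTransportW φ fun b => (U b)⁻¹)
        (Δ₁ := hessOp φ η U τ) (Rr := RofU L m φ η U) (Q := Q) (a := a) hpos hQs)
      (B11Eq103H1Complex.DFun φ (B11Eq103H1Complex.covDerivL2K ℂ c₀ ((η : ℂ))⁻¹ (adTransportW φ U))) (RofU L m φ η U)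
      (B11Eq103H1Complex.DstarFun φ (B11Eq103H1Complex.covDivL2K ℂ c₀ ((η : ℂ))⁻¹ (adTransportW φ fun b => (U b)⁻¹))))
    (B11Eq111FrakG.frakGLin
      (B11Eq103H1Complex.G1Fun φ (B11Eq103H1Complex.G1LatticeK (c := ((η : ℂ))⁻¹) (R := adTransportW φ (gaugeU g U))
        (S := adTransportW φ fun b => (gaugeU g U b)⁻¹) (Δ₁ := hessOp φ η (gaugeU g U) τ) (Rr := RofU L m φ η (gaugeU g U)) (Q := Q') (a := a) hpos'))
      (B11Eq103H1Complex.QFun φ Q') (B11Eq103H1Complex.QadjFun φ Q')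
      (B11Eq103H1Complex.KinvLatticeK (c := ((η : ℂ))⁻¹) (R := adTransportW φ (gaugeU g U)) (S := adTransportW φ fun b => (gaugeU g U b)⁻¹)
        (Δ₁ := hessOp φ η (gaugeU g U) τ) (Rr := RofU L m φ η (gaugeU g U)) (Q := Q') (a := a) hpos' hQs')
      (B11Eq103H1Complex.DFun φ (B11Eq103H1Complex.covDerivL2K ℂ c₀ ((η : ℂ))⁻¹ (adTransportW φ (gaugeU g U)))) (RofU L m φ η (gaugeU g U))
      (B11Eq103H1Complex.DstarFun φ (B11Eq103H1Complex.covDivL2K ℂ c₀ ((η : ℂ))⁻¹ (adTransportW φ fun b => (gaugeU g U b)⁻¹))))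
    (fun F => ?_) J
  have hTF : ∀ h h' : WL2 ℂ wB W, ⟪gaugeW φ u h, gaugeW φ u h'⟫_ℂ = ⟪h, h'⟫_ℂ := fun h h' => inner_gaugeW φ (w := wB) u hAdu h h'
  have h1 := frakGofU_gaugeU L m φ τ η U (gaugeW φ u) hτ hstar hAd hTF hQ hpos hpos' hQs hQs'
    ((funEquiv φ (fun _ : Bond d (fineP L m) => c₀)).symm F)
  rw [frakGLin_fun_apply L m φ hpos' hQs', frakGLin_fun_apply L m φ hpos hQs, symm_funEquiv_gaugeA]
  exact (congrArg (funEquiv φ (fun _ : Bond d (fineP L m) => c₀)) h1).trans (toAlg_gaugeW_eq_gaugeA φ g _)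

include hτ hstar hAd hAdu hQ in
set_option maxHeartbeats 1600000 in
set_option maxRecDepth 8192 in
-- as above
/-- **`‖𝔊(U^u)‖ = ‖𝔊(U)‖` IN THE (115)-CURRENCY** (`u(x) ∈ U1`). [cite: Balaban1985Variational, (117) p.295; Balaban1985BackgroundPropagators, (3.34) p.396, (3.153) p.426] -/
theorem opNorm_frakGLatticeCLM_gaugeU (hg : ∀ x, g x ∈ U1 𝔸) :
    ‖B11Eq103H1Complex.frakGLatticeCLM (L := Lr) (η := η) (lev₀ := lev₀) φ (c := ((η : ℂ))⁻¹) (R := adTransportW φ (gaugeU g U))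
        (S := adTransportW φ fun b => (gaugeU g U b)⁻¹) (Δ₁ := hessOp φ η (gaugeU g U) τ) (Rr := RofU L m φ η (gaugeU g U)) (Q := Q') (a := a)
        hpos' hQs' lev₁ (nabla115 η (gaugeU g U))‖ =
      ‖B11Eq103H1Complex.frakGLatticeCLM (L := Lr) (η := η) (lev₀ := lev₀) φ (c := ((η : ℂ))⁻¹) (R := adTransportW φ U)
        (S := adTransportW φ fun b => (U b)⁻¹) (Δ₁ := hessOp φ η U τ) (Rr := RofU L m φ η U) (Q := Q) (a := a) hpos hQs lev₁ (nabla115 η U)‖ :=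
  opNorm_eq_of_isometry_conj (gaugeNeg (w := levWeight Lr η lev₀ 3) (fun b : Bond d (fineP L m) => g (bpos b)) fun _ => hg _)
    (gauge115Isometry (lev₀ := lev₀) (lev₁ := lev₁) hg U) _ _
    fun J => frakGLatticeCLM_gaugeU L m φ lev₁ τ U u hτ hstar hAd hAdu hQ hpos hpos' hQs hQs' J

end FrakG

end Literature.MathematicalPhysics.QuantumFieldTheory.Balaban1983to89.B11Eq117GaugeNormInvariance

end
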